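import Literature.Barriers.AtomisticToContinuum.DisorderedHarmonicChainPotential
import Mathlib.Analysis.Calculus.BumpFunction.Basic
import Mathlib.Analysis.Calculus.BumpFunction.InnerProduct
import Mathlib.Analysis.Calculus.Deriv.Support
import Mathlib.MeasureTheory.Integral.IntervalIntegral.IntegrationByParts
import Mathlib.MeasureTheory.Integral.Prod
import HarnessLib

/-!
# Ajanki–Huveneers 2011: integration by parts on the disorder space `τ^{⊗n}`

Second file of the integration-by-parts route to the low-frequency upper bound (U) of
`…Transfer.lean` (O. Ajanki, F. Huveneers, CMP **301** (2011) 841–883, arXiv:1003.1076, §5–§6: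
the paper obtains the density bounds of Prop. 5.1 for the phase chain by a parametrix; we obtain
the upper bound by a Malliavin-type integration by parts along the reduced masses `B_k`, whose
law `τ(b) db` has a `C¹` density). This file supplies the measure-theoretic tool, independent of
the chain:

* `integral_pi_update`: resampling one coordinate, `∫ F dτ^{⊗(n+1)} = ∫∫ F(B[k ↦ b]) τ(db) τ^{⊗(n+1)}(dB)`
  (from `measurePreserving_piFinSuccAbove`), and its corollary `integral_pi_mul_coord`
  (`𝔼[F · g(B_k)] = 𝔼F · 𝔼g` when `F` does not depend on `B_k`).
* `SmoothingField τ bm bp`: a smooth bump `ξ ∈ [0,1]` supported where `τ ≥ τ_min > 0`, strictly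
  inside `(b₋, b₊)`, with the logarithmic derivative `ℓ = (ξτ)'/τ` and the one-dimensional
  integration by parts `∫ ξ v' τ = -∫ ℓ v τ` for `v ∈ C¹[b₋, b₊]`, `∫ ℓ τ = 0`, `∫ ℓ² τ < ∞`,
  `∫ ξ τ > 0`; `smoothingField hτ` constructs one from `ReducedLawHyp τ bm bp`
  (continuity of `τ`, `∫τ = 1`, `C¹` inside the support: `ContDiffBump` of Mathlib).
* `pi_ibp`: the product-space identity `𝔼[a(B) ξ(B_k) ∂_k Ψ(B)] = -𝔼[a(B) ℓ(B_k) Ψ(B)]` for a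
  coefficient `a` not depending on `B_k` and `Ψ` continuously differentiable in `B_k`.

[cite: AjankiHuveneers2011, §5 (Prop. 5.1) — alternative route; folklore (integration by parts)]
-/

noncomputable section

open Real MeasureTheory Set Filter Function

namespace Literature.Barriers.AtomisticToContinuum.HeatConduction

/-! ### Resampling one coordinate of `τ^{⊗(n+1)}` -/

section Resample

variable (ρ : Measure ℝ) [IsProbabilityMeasure ρ]

/-- `B[k ↦ b] = insertNth k b (removeNth k B)` in terms of the measurable equivalence
`piFinSuccAbove`. [folklore] -/
theorem update_eq_piFinSuccAbove_symm {n : ℕ} (k : Fin (n + 1)) (B : Fin (n + 1) → ℝ) (b : ℝ) :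
    Function.update B k b =
      (MeasurableEquiv.piFinSuccAbove (fun _ : Fin (n + 1) => ℝ) k).symm
        (b, ((MeasurableEquiv.piFinSuccAbove (fun _ : Fin (n + 1) => ℝ) k) B).2) := by
  rw [MeasurableEquiv.piFinSuccAbove_symm_apply, MeasurableEquiv.piFinSuccAbove_apply]
  simp [Fin.insertNthEquiv, Fin.insertNth_removeNth]

/-- **Resampling one coordinate**: for `F` integrable against `ρ^{⊗(n+1)}` and a probability `ρ`,
`∫ F dρ^{⊗(n+1)} = ∫ (∫ F(B[k ↦ b]) ρ(db)) ρ^{⊗(n+1)}(dB)`. [folklore] -/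
theorem integral_pi_update {n : ℕ} (k : Fin (n + 1)) (F : (Fin (n + 1) → ℝ) → ℝ)
    (hF : Integrable F (Measure.pi fun _ : Fin (n + 1) => ρ)) :
    ∫ B, F B ∂(Measure.pi fun _ : Fin (n + 1) => ρ) =
      ∫ B, (∫ b, F (Function.update B k b) ∂ρ) ∂(Measure.pi fun _ : Fin (n + 1) => ρ) := by
  set e := MeasurableEquiv.piFinSuccAbove (fun _ : Fin (n + 1) => ℝ) k with he
  have hmp : MeasurePreserving e (Measure.pi fun _ : Fin (n + 1) => ρ)
      (ρ.prod (Measure.pi fun _ : Fin n => ρ)) :=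
    measurePreserving_piFinSuccAbove (fun _ : Fin (n + 1) => ρ) k
  have hmp' := hmp.symm e
  set G' : (Fin n → ℝ) → ℝ := fun B' => ∫ b, F (e.symm (b, B')) ∂ρ with hG'
  -- the right-hand side is `∫ G'((e B).2)`
  have hR : (fun B : Fin (n + 1) → ℝ => ∫ b, F (Function.update B k b) ∂ρ) = fun B => G' (e B).2 := by
    funext B
    simp only [hG']
    refine integral_congr_ae (ae_of_all _ fun b => ?_)
    show F (Function.update B k b) = F (e.symm (b, (e B).2))
    rw [update_eq_piFinSuccAbove_symm]
  rw [hR]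
  -- the left-hand side through the product decomposition
  have hI : Integrable (fun p : ℝ × (Fin n → ℝ) => F (e.symm p)) (ρ.prod (Measure.pi fun _ : Fin n => ρ)) :=
    (hmp'.integrable_comp_emb e.symm.measurableEmbedding).mpr hF
  have hL : ∫ B, F B ∂(Measure.pi fun _ : Fin (n + 1) => ρ) =
      ∫ B', G' B' ∂(Measure.pi fun _ : Fin n => ρ) := by
    rw [← hmp'.integral_comp' (f := e.symm), integral_prod_symm _ hI]
  rw [hL]
  have hR2 : ∫ B, G' (e B).2 ∂(Measure.pi fun _ : Fin (n + 1) => ρ) =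
      ∫ p, G' p.2 ∂(ρ.prod (Measure.pi fun _ : Fin n => ρ)) := by
    rw [← hmp.integral_comp' (f := e)]
  rw [hR2, integral_fun_snd]
  simp

/-- **Independence of one coordinate**: if `F` does not depend on `B_k` then
`∫ F(B) g(B_k) dρ^{⊗(n+1)} = (∫ F dρ^{⊗(n+1)}) (∫ g dρ)`. [folklore] -/
theorem integral_pi_mul_coord {n : ℕ} (k : Fin (n + 1)) (F : (Fin (n + 1) → ℝ) → ℝ)
    (hFk : ∀ B b, F (Function.update B k b) = F B) (g : ℝ → ℝ)
    (hFg : Integrable (fun B => F B * g (B k)) (Measure.pi fun _ : Fin (n + 1) => ρ)) :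
    ∫ B, F B * g (B k) ∂(Measure.pi fun _ : Fin (n + 1) => ρ) =
      (∫ B, F B ∂(Measure.pi fun _ : Fin (n + 1) => ρ)) * ∫ b, g b ∂ρ := by
  rw [integral_pi_update ρ k _ hFg]
  have h : ∀ B : Fin (n + 1) → ℝ, ∫ b, F (Function.update B k b) * g (Function.update B k b k) ∂ρ =
      F B * ∫ b, g b ∂ρ := by
    intro B
    simp only [hFk, Function.update_self]
    exact integral_const_mul _ _
  simp only [h]
  exact integral_mul_const _ _

end Resample

/-! ### A smooth bump adapted to the reduced law, and the one-dimensional integration by parts -/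

/-- **A smoothing field for the law `τ`**: a `C¹` bump `ξ ∈ [0, 1]` (with bounded derivative)
vanishing near `b₋`, `b₊` and wherever `τ` is small, its `τ`-logarithmic derivative
`ℓ = (ξτ)'/τ`, and the integration-by-parts identity `∫ ξ v' τ = -∫ ℓ v τ` for `v ∈ C¹[b₋, b₊]`,
together with `∫ ℓ τ = 0`, `∫ ℓ² τ ≤ C_ℓ`, `∫ ξ τ > 0`, `|ℓ| τ ≤ C`. This is the structure the
Malliavin-type integration by parts along one reduced mass needs. [folklore] -/
structure SmoothingField (τ : ℝ → ℝ) (bm bp : ℝ) where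
  /-- the bump -/
  ξ : ℝ → ℝ
  /-- the logarithmic derivative `(ξτ)'/τ` -/
  ℓ : ℝ → ℝ
  ξ_nonneg : ∀ b, 0 ≤ ξ b
  ξ_le_one : ∀ b, ξ b ≤ 1
  ξ_contDiff : ContDiff ℝ 1 ξ
  ξ_deriv_bound : ∃ C, ∀ b, |deriv ξ b| ≤ C
  ξ_measurable : Measurable ξ
  ℓ_measurable : Measurable ℓ
  /-- `|ℓ| τ` is bounded (so `ℓ(B) Ψ(B)` is integrable for bounded `Ψ`) -/
  ℓ_mul_bound : ∃ C, ∀ b, |ℓ b| * τ b ≤ C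
  /-- `ℓ` vanishes off `[b₋, b₊]` -/
  ℓ_eq_zero : ∀ b ∉ Set.Icc bm bp, ℓ b = 0
  /-- `∫ ξ τ > 0` -/
  mass_pos : 0 < ∫ b, ξ b * τ b
  /-- `𝔼 ℓ(B) = 0` -/
  ℓ_mean_zero : ∫ b, ℓ b * τ b = 0
  /-- `𝔼 ℓ(B)² < ∞`, quantitatively -/
  ℓ_sq_bound : ∃ C, Integrable (fun b => ℓ b ^ 2 * τ b) ∧ ∫ b, ℓ b ^ 2 * τ b ≤ C
  /-- **the one-dimensional integration by parts** `∫ ξ v' τ = -∫ ℓ v τ` for `v ∈ C¹[b₋, b₊]` -/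
  ibp : ∀ v v' : ℝ → ℝ, (∀ b ∈ Set.Icc bm bp, HasDerivAt v (v' b) b) →
    ContinuousOn v' (Set.Icc bm bp) →
      ∫ b, ξ b * v' b * τ b = -∫ b, ℓ b * v b * τ b

namespace ReducedLawHyp

variable {τ : ℝ → ℝ} {bm bp : ℝ}

/-- A point of the open support interval where the density is positive (`∫ τ = 1`). [folklore] -/
theorem exists_pos (hτ : ReducedLawHyp τ bm bp) : ∃ b₀ ∈ Set.Ioo bm bp, 0 < τ b₀ := by
  by_contra h
  push Not at h
  have hzero : ∀ b, b ≠ bm → b ≠ bp → τ b = 0 := by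
    intro b h1 h2
    by_cases hb : b ∈ Set.Icc bm bp
    · have hb' : b ∈ Set.Ioo bm bp := ⟨lt_of_le_of_ne hb.1 (Ne.symm h1), lt_of_le_of_ne hb.2 h2⟩
      exact le_antisymm (h b hb') (hτ.nonneg b)
    · exact hτ.eq_zero b hb
  have hae : (fun b => τ b) =ᵐ[volume] fun _ => (0 : ℝ) := by
    have hS : (volume : Measure ℝ) {bm, bp} = 0 :=
      (Set.toFinite ({bm, bp} : Set ℝ)).measure_zero volume
    refine (ae_iff.mpr ?_)
    refine measure_mono_null (fun b hb => ?_) hS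
    simp only [Set.mem_setOf_eq] at hb
    by_contra hn
    simp only [Set.mem_insert_iff, Set.mem_singleton_iff, not_or] at hn
    exact hb (hzero b hn.1 hn.2)
  have h1 := hτ.integral_eq_one
  rw [integral_congr_ae hae, integral_zero] at h1
  exact zero_ne_one h1

/-- **A window of positivity**: `c`, `r > 0`, `τ_min > 0` with `[c - 8r, c + 8r] ⊂ (b₋, b₊)` and
`τ ≥ τ_min` on `[c - 8r, c + 8r]`. [folklore] -/
theorem exists_window (hτ : ReducedLawHyp τ bm bp) :
    ∃ c r τmin : ℝ, 0 < r ∧ 0 < τmin ∧ bm < c - 8 * r ∧ c + 8 * r < bp ∧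
      ∀ b, dist b c ≤ 8 * r → τmin ≤ τ b := by
  obtain ⟨b₀, hb₀, hpos⟩ := hτ.exists_pos
  have hcont : ContinuousAt τ b₀ :=
    hτ.continuousOn.continuousAt (Icc_mem_nhds hb₀.1 hb₀.2)
  obtain ⟨δ, hδ, hball⟩ := Metric.continuousAt_iff.mp hcont (τ b₀ / 2) (by linarith)
  set r := min (δ / 16) (min (b₀ - bm) (bp - b₀) / 16) with hr
  have hr0 : 0 < r := by
    rw [hr]
    refine lt_min (by linarith) ?_
    have : 0 < min (b₀ - bm) (bp - b₀) := lt_min (by linarith [hb₀.1]) (by linarith [hb₀.2])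
    linarith
  have hrδ : 8 * r < δ := by
    have : r ≤ δ / 16 := min_le_left _ _
    linarith
  have hr1 : 8 * r < b₀ - bm := by
    have : r ≤ min (b₀ - bm) (bp - b₀) / 16 := min_le_right _ _
    have := min_le_left (b₀ - bm) (bp - b₀)
    linarith
  have hr2 : 8 * r < bp - b₀ := by
    have : r ≤ min (b₀ - bm) (bp - b₀) / 16 := min_le_right _ _
    have := min_le_right (b₀ - bm) (bp - b₀)
    linarith
  refine ⟨b₀, r, τ b₀ / 2, hr0, by linarith, by linarith, by linarith, fun b hb => ?_⟩
  have hd : dist b b₀ < δ := lt_of_le_of_lt hb hrδ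
  have := hball hd
  rw [Real.dist_eq] at this
  have := abs_lt.mp this
  linarith

end ReducedLawHyp

/-! #### Construction of the smoothing field -/

section Construction

variable {τ : ℝ → ℝ} {bm bp : ℝ}

/-- The data of the construction: a window of positivity and the bump on it. [folklore] -/
structure SFData (τ : ℝ → ℝ) (bm bp : ℝ) where
  /-- centre of the window -/
  c : ℝ
  /-- radius unit -/
  r : ℝ
  /-- lower bound of `τ` on the window -/
  τmin : ℝ
  r_pos : 0 < r
  τmin_pos : 0 < τmin
  lo : bm < c - 8 * r
  hi : c + 8 * r < bp
  τ_ge : ∀ b, dist b c ≤ 8 * r → τmin ≤ τ b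

namespace SFData

variable (D : SFData τ bm bp)

/-- The bump: `1` on `[c - r, c + r]`, `0` off `(c - 2r, c + 2r)`. [folklore] -/
def bump : ContDiffBump D.c := ⟨D.r, 2 * D.r, D.r_pos, by linarith [D.r_pos]⟩

/-- The bump as a real function. [folklore] -/
def ξ : ℝ → ℝ := fun b => (D.bump : ℝ → ℝ) b

/-- `u = ξ τ`. [folklore] -/
def u : ℝ → ℝ := fun b => D.ξ b * τ b

/-- `ℓ = u'/τ` (junk `0` where `τ = 0`, where `u' = 0` anyway). [folklore] -/
def ℓ : ℝ → ℝ := fun b => deriv D.u b / τ b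

/-- The outer radius of the bump is `2r`. [folklore] -/
theorem bump_rOut : D.bump.rOut = 2 * D.r := rfl

/-- The inner radius of the bump is `r`. [folklore] -/
theorem bump_rIn : D.bump.rIn = D.r := rfl

/-- `ξ ≥ 0`. [folklore] -/
theorem ξ_nonneg (b : ℝ) : 0 ≤ D.ξ b := D.bump.nonneg

/-- `ξ ≤ 1`. [folklore] -/
theorem ξ_le_one (b : ℝ) : D.ξ b ≤ 1 := D.bump.le_one

/-- `ξ ∈ C¹`. [folklore] -/
theorem ξ_contDiff : ContDiff ℝ 1 D.ξ := D.bump.contDiff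

/-- `ξ` is continuous. [folklore] -/
theorem ξ_continuous : Continuous D.ξ := D.bump.continuous

/-- `ξ = 0` at distance `≥ 2r` from the centre. [folklore] -/
theorem ξ_eq_zero {b : ℝ} (hb : 2 * D.r ≤ dist b D.c) : D.ξ b = 0 :=
  D.bump.zero_of_le_dist (by rw [bump_rOut]; exact hb)

/-- `ξ = 1` at distance `≤ r` from the centre. [folklore] -/
theorem ξ_eq_one {b : ℝ} (hb : dist b D.c ≤ D.r) : D.ξ b = 1 :=
  D.bump.one_of_mem_closedBall (by rw [Metric.mem_closedBall, bump_rIn]; exact hb)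

/-- `ξ` has compact support. [folklore] -/
theorem ξ_hasCompactSupport : HasCompactSupport D.ξ := D.bump.hasCompactSupport

/-- `ξ` is differentiable. [folklore] -/
theorem ξ_differentiable : Differentiable ℝ D.ξ := D.ξ_contDiff.differentiable one_ne_zero

/-- `ξ'` is bounded. [folklore] -/
theorem ξ_deriv_bound : ∃ C, ∀ b, |deriv D.ξ b| ≤ C := by
  have hc : Continuous (deriv D.ξ) := D.ξ_contDiff.continuous_deriv le_rfl
  have hs : HasCompactSupport (deriv D.ξ) := D.ξ_hasCompactSupport.deriv
  obtain ⟨C, hC⟩ := hc.bounded_above_of_compact_support hs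
  exact ⟨C, fun b => by simpa [Real.norm_eq_abs] using hC b⟩

/-- `ξ` vanishes on a neighbourhood of every point at distance `> 2r` from the centre. [folklore] -/
theorem ξ_eventuallyEq_zero {b : ℝ} (hb : 2 * D.r < dist b D.c) : D.ξ =ᶠ[nhds b] fun _ => 0 := by
  have hopen : IsOpen {y : ℝ | 2 * D.r < dist y D.c} :=
    isOpen_lt continuous_const (continuous_id.dist continuous_const)
  filter_upwards [hopen.mem_nhds hb] with y hy
  exact D.ξ_eq_zero (le_of_lt hy)

/-- Points of the enlarged window lie in the open support interval. [folklore] -/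
theorem mem_Ioo_of_dist {b : ℝ} (hb : dist b D.c < 8 * D.r) : b ∈ Set.Ioo bm bp := by
  rw [Real.dist_eq] at hb
  have := abs_lt.mp hb
  constructor <;> linarith [D.lo, D.hi]

/-- `τ` is differentiable at the points of the enlarged window. [folklore] -/
theorem τ_differentiableAt (hτ : ReducedLawHyp τ bm bp) {b : ℝ} (hb : dist b D.c < 8 * D.r) :
    DifferentiableAt ℝ τ b := by
  have hmem := D.mem_Ioo_of_dist hb
  exact (hτ.contDiffOn.differentiableOn one_ne_zero).differentiableAt (Ioo_mem_nhds hmem.1 hmem.2)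

/-- `u` is differentiable everywhere. [folklore] -/
theorem u_differentiableAt (hτ : ReducedLawHyp τ bm bp) (b : ℝ) : DifferentiableAt ℝ D.u b := by
  by_cases hb : dist b D.c < 8 * D.r
  · exact (D.ξ_differentiable b).mul (D.τ_differentiableAt hτ hb)
  · push Not at hb
    have hfar : 2 * D.r < dist b D.c := by linarith [D.r_pos]
    have hev : D.u =ᶠ[nhds b] fun _ => 0 := by
      filter_upwards [D.ξ_eventuallyEq_zero hfar] with y hy
      simp [u, hy]
    exact (hev.differentiableAt_iff).mpr (differentiableAt_const _)

/-- `u` has derivative `u'` everywhere. [folklore] -/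
theorem u_hasDerivAt (hτ : ReducedLawHyp τ bm bp) (b : ℝ) : HasDerivAt D.u (deriv D.u b) b :=
  (D.u_differentiableAt hτ b).hasDerivAt

/-- `u' = ξ'τ + ξτ'` on the enlarged window. [folklore] -/
theorem deriv_u_eq (hτ : ReducedLawHyp τ bm bp) {b : ℝ} (hb : dist b D.c < 8 * D.r) :
    deriv D.u b = deriv D.ξ b * τ b + D.ξ b * deriv τ b := by
  have h := ((D.ξ_differentiable b).hasDerivAt).mul (D.τ_differentiableAt hτ hb).hasDerivAt
  exact h.deriv

/-- `u' = 0` away from the bump. [folklore] -/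
theorem deriv_u_eq_zero {b : ℝ} (hb : 2 * D.r < dist b D.c) : deriv D.u b = 0 := by
  have hev : D.u =ᶠ[nhds b] fun _ => (0 : ℝ) := by
    filter_upwards [D.ξ_eventuallyEq_zero hb] with y hy
    simp [u, hy]
  rw [hev.deriv_eq]
  simp

/-- `u = 0` away from the bump. [folklore] -/
theorem u_eq_zero {b : ℝ} (hb : 2 * D.r ≤ dist b D.c) : D.u b = 0 := by
  simp [u, D.ξ_eq_zero hb]

/-- A uniform bound on `u'`. [folklore] -/
theorem deriv_u_bound (hτ : ReducedLawHyp τ bm bp) : ∃ C, 0 ≤ C ∧ ∀ b, |deriv D.u b| ≤ C := by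
  obtain ⟨Cξ, hCξ⟩ := D.ξ_deriv_bound
  obtain ⟨Cτ, hCτ0, hCτ⟩ := hτ.exists_bound
  obtain ⟨Cd, hCd⟩ := hτ.deriv_bound
  have hCξ0 : 0 ≤ Cξ := (abs_nonneg _).trans (hCξ 0)
  refine ⟨Cξ * Cτ + |Cd|, by positivity, fun b => ?_⟩
  by_cases hb : dist b D.c < 8 * D.r
  · rw [D.deriv_u_eq hτ hb]
    have hmem := D.mem_Ioo_of_dist hb
    calc |deriv D.ξ b * τ b + D.ξ b * deriv τ b|
        ≤ |deriv D.ξ b * τ b| + |D.ξ b * deriv τ b| := abs_add_le _ _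
      _ ≤ Cξ * Cτ + |Cd| := by
          refine add_le_add ?_ ?_
          · rw [abs_mul]
            exact mul_le_mul (hCξ b) (hCτ b) (abs_nonneg _) hCξ0
          · rw [abs_mul, abs_of_nonneg (D.ξ_nonneg b)]
            calc D.ξ b * |deriv τ b| ≤ 1 * |Cd| :=
                  mul_le_mul (D.ξ_le_one b) ((hCd b hmem).trans (le_abs_self _)) (abs_nonneg _) zero_le_one
              _ = |Cd| := one_mul _
  · push Not at hb
    rw [D.deriv_u_eq_zero (by linarith [D.r_pos])]
    simp only [abs_zero]
    positivity

/-- `τ ℓ = u'` pointwise. [folklore] -/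
theorem τ_mul_ℓ (b : ℝ) : τ b * D.ℓ b = deriv D.u b := by
  unfold ℓ
  by_cases h : τ b = 0
  · have hfar : 2 * D.r < dist b D.c := by
      by_contra hn
      push Not at hn
      have := D.τ_ge b (by linarith [D.r_pos])
      linarith [D.τmin_pos]
    rw [D.deriv_u_eq_zero hfar, h]
    simp
  · field_simp

/-- `ξ` is measurable. [folklore] -/
theorem ξ_measurable : Measurable D.ξ := D.ξ_continuous.measurable

/-- `ℓ` is measurable. [folklore] -/
theorem ℓ_measurable (hτ : ReducedLawHyp τ bm bp) : Measurable D.ℓ :=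
  (measurable_deriv D.u).div hτ.measurable

/-- `ℓ = 0` at distance `> 2r` from the centre. [folklore] -/
theorem ℓ_eq_zero_of_far {b : ℝ} (hb : 2 * D.r < dist b D.c) : D.ℓ b = 0 := by
  unfold ℓ
  rw [D.deriv_u_eq_zero hb, zero_div]

/-- `ℓ = 0` off `[b₋, b₊]`. [folklore] -/
theorem ℓ_eq_zero_of_not_mem {b : ℝ} (hb : b ∉ Set.Icc bm bp) : D.ℓ b = 0 := by
  apply D.ℓ_eq_zero_of_far
  by_contra hn
  push Not at hn
  have := D.mem_Ioo_of_dist (lt_of_le_of_lt hn (by linarith [D.r_pos]))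
  exact hb ⟨this.1.le, this.2.le⟩

/-- `|ℓ| τ ≤ C`. [folklore] -/
theorem ℓ_mul_bound (hτ : ReducedLawHyp τ bm bp) : ∃ C, ∀ b, |D.ℓ b| * τ b ≤ C := by
  obtain ⟨C, -, hC⟩ := D.deriv_u_bound hτ
  refine ⟨C, fun b => ?_⟩
  have h := D.τ_mul_ℓ b
  calc |D.ℓ b| * τ b = |τ b * D.ℓ b| := by
        rw [abs_mul, abs_of_nonneg (hτ.nonneg b), mul_comm]
    _ = |deriv D.u b| := by rw [h]
    _ ≤ C := hC b

/-- `|ℓ| ≤ C/τ_min` everywhere. [folklore] -/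
theorem abs_ℓ_le (hτ : ReducedLawHyp τ bm bp) : ∃ C, 0 ≤ C ∧ ∀ b, |D.ℓ b| ≤ C := by
  obtain ⟨C, hC0, hC⟩ := D.deriv_u_bound hτ
  refine ⟨C / D.τmin, div_nonneg hC0 D.τmin_pos.le, fun b => ?_⟩
  by_cases hb : 2 * D.r < dist b D.c
  · rw [D.ℓ_eq_zero_of_far hb, abs_zero]
    exact div_nonneg hC0 D.τmin_pos.le
  · push Not at hb
    have hτb : D.τmin ≤ τ b := D.τ_ge b (by linarith [D.r_pos])
    have hτpos : 0 < τ b := lt_of_lt_of_le D.τmin_pos hτb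
    unfold ℓ
    rw [abs_div, abs_of_pos hτpos, div_le_div_iff₀ hτpos D.τmin_pos]
    calc |deriv D.u b| * D.τmin ≤ C * D.τmin := mul_le_mul_of_nonneg_right (hC b) D.τmin_pos.le
      _ ≤ C * τ b := mul_le_mul_of_nonneg_left hτb hC0

/-- **The one-dimensional integration by parts** `∫ ξ v' τ = -∫ ℓ v τ` (over `ℝ`) for
`v ∈ C¹[b₋, b₊]`: `u = ξτ` vanishes at `b₋`, `b₊`. [folklore] -/
theorem ibp (hτ : ReducedLawHyp τ bm bp) (v v' : ℝ → ℝ)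
    (hv : ∀ b ∈ Set.Icc bm bp, HasDerivAt v (v' b) b) (hv' : ContinuousOn v' (Set.Icc bm bp)) :
    ∫ b, D.ξ b * v' b * τ b = -∫ b, D.ℓ b * v b * τ b := by
  have hle : bm ≤ bp := hτ.lt.le
  obtain ⟨C, hC0, hC⟩ := D.deriv_u_bound hτ
  -- both integrands vanish off `[bm, bp]`
  have h1 : ∫ b, D.ξ b * v' b * τ b = ∫ b in bm..bp, D.u b * v' b := by
    rw [intervalIntegral.integral_of_le hle, ← integral_Icc_eq_integral_Ioc]
    rw [← setIntegral_eq_integral_of_forall_compl_eq_zero (s := Set.Icc bm bp)]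
    · refine setIntegral_congr_fun measurableSet_Icc fun b _ => ?_
      simp only [u]; ring
    · intro b hb
      rw [hτ.eq_zero b hb, mul_zero]
  have h2 : ∫ b, D.ℓ b * v b * τ b = ∫ b in bm..bp, deriv D.u b * v b := by
    rw [intervalIntegral.integral_of_le hle, ← integral_Icc_eq_integral_Ioc]
    rw [← setIntegral_eq_integral_of_forall_compl_eq_zero (s := Set.Icc bm bp)]
    · refine setIntegral_congr_fun measurableSet_Icc fun b _ => ?_
      rw [← D.τ_mul_ℓ b]; ring
    · intro b hb
      rw [hτ.eq_zero b hb, mul_zero]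
  rw [h1, h2]
  have hvc : ContinuousOn v (Set.Icc bm bp) := fun b hb =>
    (hv b hb).continuousAt.continuousWithinAt
  have hu : ∀ b ∈ Set.uIcc bm bp, HasDerivAt D.u (deriv D.u b) b := fun b _ => D.u_hasDerivAt hτ b
  have hv2 : ∀ b ∈ Set.uIcc bm bp, HasDerivAt v (v' b) b := by
    rw [Set.uIcc_of_le hle]; exact hv
  have hu' : IntervalIntegrable (deriv D.u) volume bm bp := by
    refine (intervalIntegrable_iff_integrableOn_Ioc_of_le hle).mpr ?_
    refine Measure.integrableOn_of_bounded (M := C) measure_Ioc_lt_top.ne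
      (measurable_deriv D.u).aestronglyMeasurable (ae_of_all _ fun b => ?_)
    rw [Real.norm_eq_abs]; exact hC b
  have hv'' : IntervalIntegrable v' volume bm bp := by
    refine (hv'.mono ?_).intervalIntegrable
    rw [Set.uIcc_of_le hle]
  have key := intervalIntegral.integral_mul_deriv_eq_deriv_mul hu hv2 hu' hv''
  have hlo := D.lo
  have hhi := D.hi
  have hr := D.r_pos
  have hubm : D.u bm = 0 := D.u_eq_zero (by
    rw [Real.dist_eq, abs_of_neg (by linarith)]; linarith)
  have hubp : D.u bp = 0 := D.u_eq_zero (by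
    rw [Real.dist_eq, abs_of_pos (by linarith)]; linarith)
  rw [key, hubm, hubp]
  simp

/-- `∫ ℓ τ = 0` (integration by parts against `v = 1`). [folklore] -/
theorem ℓ_mean_zero (hτ : ReducedLawHyp τ bm bp) : ∫ b, D.ℓ b * τ b = 0 := by
  have h := D.ibp hτ (fun _ => 1) (fun _ => 0) (fun b _ => hasDerivAt_const b 1) continuousOn_const
  simp only [mul_zero, zero_mul, integral_zero, mul_one] at h
  linarith

/-- `∫ ξ τ > 0`. [folklore] -/
theorem mass_pos (hτ : ReducedLawHyp τ bm bp) : 0 < ∫ b, D.ξ b * τ b := by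
  have hr := D.r_pos
  -- lower bound by `τ_min` on `[c - r, c + r]`
  have hint : Integrable (fun b => D.ξ b * τ b) := by
    refine hτ.integrable_mul D.ξ_continuous.aestronglyMeasurable (C := 1) fun b _ => ?_
    rw [abs_of_nonneg (D.ξ_nonneg b)]; exact D.ξ_le_one b
  have hind : ∀ b, (Set.Icc (D.c - D.r) (D.c + D.r)).indicator (fun _ => D.τmin) b ≤ D.ξ b * τ b := by
    intro b
    by_cases hb : b ∈ Set.Icc (D.c - D.r) (D.c + D.r)
    · rw [Set.indicator_of_mem hb]
      have hd : dist b D.c ≤ D.r := by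
        rw [Real.dist_eq]; exact abs_le.mpr ⟨by linarith [hb.1], by linarith [hb.2]⟩
      rw [D.ξ_eq_one hd, one_mul]
      exact D.τ_ge b (by linarith)
    · rw [Set.indicator_of_notMem hb]
      exact mul_nonneg (D.ξ_nonneg b) (hτ.nonneg b)
  calc (0 : ℝ) < D.τmin * (2 * D.r) := by have := D.τmin_pos; positivity
    _ = ∫ b, (Set.Icc (D.c - D.r) (D.c + D.r)).indicator (fun _ => D.τmin) b := by
        rw [integral_indicator measurableSet_Icc, setIntegral_const, Real.volume_real_Icc_of_le (by linarith)]
        rw [smul_eq_mul]; ring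
    _ ≤ ∫ b, D.ξ b * τ b := by
        have hii : Integrable ((Set.Icc (D.c - D.r) (D.c + D.r)).indicator fun _ => D.τmin) := by
          rw [integrable_indicator_iff measurableSet_Icc]
          exact integrableOn_const (measure_Icc_lt_top.ne)
        exact integral_mono hii hint hind

/-- `∫ ℓ² τ ≤ C`. [folklore] -/
theorem ℓ_sq_bound (hτ : ReducedLawHyp τ bm bp) :
    ∃ C, Integrable (fun b => D.ℓ b ^ 2 * τ b) ∧ ∫ b, D.ℓ b ^ 2 * τ b ≤ C := by
  obtain ⟨A, hA0, hA⟩ := D.abs_ℓ_le hτ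
  have hint : Integrable (fun b => D.ℓ b ^ 2 * τ b) := by
    refine hτ.integrable_mul ((D.ℓ_measurable hτ).pow_const 2).aestronglyMeasurable (C := A ^ 2)
      fun b _ => ?_
    rw [abs_of_nonneg (sq_nonneg _), ← sq_abs]
    exact pow_le_pow_left₀ (abs_nonneg _) (hA b) 2
  refine ⟨A ^ 2 * 1, hint, ?_⟩
  calc ∫ b, D.ℓ b ^ 2 * τ b ≤ ∫ b, A ^ 2 * τ b := by
        refine integral_mono hint (hτ.integrable.const_mul _) fun b => ?_
        refine mul_le_mul_of_nonneg_right ?_ (hτ.nonneg b)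
        rw [← sq_abs]
        exact pow_le_pow_left₀ (abs_nonneg _) (hA b) 2
    _ = A ^ 2 * 1 := by rw [integral_const_mul, hτ.integral_eq_one]

/-- The smoothing field packaged. [folklore] -/
def toSmoothingField (hτ : ReducedLawHyp τ bm bp) : SmoothingField τ bm bp where
  ξ := D.ξ
  ℓ := D.ℓ
  ξ_nonneg := D.ξ_nonneg
  ξ_le_one := D.ξ_le_one
  ξ_contDiff := D.ξ_contDiff
  ξ_deriv_bound := D.ξ_deriv_bound
  ξ_measurable := D.ξ_measurable
  ℓ_measurable := D.ℓ_measurable hτ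
  ℓ_mul_bound := D.ℓ_mul_bound hτ
  ℓ_eq_zero := fun _ hb => D.ℓ_eq_zero_of_not_mem hb
  mass_pos := D.mass_pos hτ
  ℓ_mean_zero := D.ℓ_mean_zero hτ
  ℓ_sq_bound := D.ℓ_sq_bound hτ
  ibp := D.ibp hτ

end SFData

/-- **Existence of the data**, from `ReducedLawHyp`. [folklore] -/
def sfData (hτ : ReducedLawHyp τ bm bp) : SFData τ bm bp :=
  ⟨hτ.exists_window.choose, hτ.exists_window.choose_spec.choose,
    hτ.exists_window.choose_spec.choose_spec.choose,
    hτ.exists_window.choose_spec.choose_spec.choose_spec.1,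
    hτ.exists_window.choose_spec.choose_spec.choose_spec.2.1,
    hτ.exists_window.choose_spec.choose_spec.choose_spec.2.2.1,
    hτ.exists_window.choose_spec.choose_spec.choose_spec.2.2.2.1,
    hτ.exists_window.choose_spec.choose_spec.choose_spec.2.2.2.2⟩

/-- **The smoothing field of a reduced law.** [folklore] -/
def smoothingField (hτ : ReducedLawHyp τ bm bp) : SmoothingField τ bm bp :=
  (sfData hτ).toSmoothingField hτ

end Construction

/-! ### The integration by parts on the product space -/

section ProductIBP

variable {τ : ℝ → ℝ} {bm bp : ℝ}

/-- **Integration by parts along one reduced mass.** For a coefficient `a` not depending on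
`B_k`, a function `Ψ` whose section `b ↦ Ψ(B[k ↦ b])` is `C¹` on `[b₋, b₊]` with derivative
`D(B[k ↦ b])`, continuous in `b`:
`∫ a(B) ξ(B_k) D(B) dτ^{⊗(n+1)} = -∫ a(B) ℓ(B_k) Ψ(B) dτ^{⊗(n+1)}`. [folklore] -/
theorem pi_ibp (hτ : ReducedLawHyp τ bm bp) (S : SmoothingField τ bm bp)
    {ρB : Measure ℝ} [IsProbabilityMeasure ρB]
    (hρ : ρB = volume.withDensity fun s => ENNReal.ofReal (τ s))
    {n : ℕ} (k : Fin (n + 1)) (a Ψ D : (Fin (n + 1) → ℝ) → ℝ)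
    (ha : ∀ B b, a (Function.update B k b) = a B)
    (hD : ∀ B, ∀ b ∈ Set.Icc bm bp,
      HasDerivAt (fun b => Ψ (Function.update B k b)) (D (Function.update B k b)) b)
    (hDc : ∀ B, ContinuousOn (fun b => D (Function.update B k b)) (Set.Icc bm bp))
    (hI1 : Integrable (fun B => a B * S.ξ (B k) * D B) (Measure.pi fun _ : Fin (n + 1) => ρB))
    (hI2 : Integrable (fun B => a B * S.ℓ (B k) * Ψ B) (Measure.pi fun _ : Fin (n + 1) => ρB)) :
    ∫ B, a B * S.ξ (B k) * D B ∂(Measure.pi fun _ : Fin (n + 1) => ρB) =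
      -∫ B, a B * S.ℓ (B k) * Ψ B ∂(Measure.pi fun _ : Fin (n + 1) => ρB) := by
  rw [integral_pi_update ρB k _ hI1, integral_pi_update ρB k _ hI2, ← integral_neg]
  refine integral_congr_ae (ae_of_all _ fun B => ?_)
  simp only [ha, Function.update_self]
  have e1 : ∫ b, a B * S.ξ b * D (Function.update B k b) ∂ρB =
      a B * ∫ b, S.ξ b * D (Function.update B k b) * τ b := by
    rw [← integral_const_mul, integral_rhoB hτ hρ]
    refine integral_congr_ae (ae_of_all _ fun b => ?_)
    ring
  have e2 : ∫ b, a B * S.ℓ b * Ψ (Function.update B k b) ∂ρB =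
      a B * ∫ b, S.ℓ b * Ψ (Function.update B k b) * τ b := by
    rw [← integral_const_mul, integral_rhoB hτ hρ]
    refine integral_congr_ae (ae_of_all _ fun b => ?_)
    ring
  rw [e1, e2, S.ibp (fun b => Ψ (Function.update B k b)) (fun b => D (Function.update B k b)) (hD B) (hDc B)]
  ring

end ProductIBP

end Literature.Barriers.AtomisticToContinuum.HeatConduction

end
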